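import Summits.RiemannHypothesis.RiemannHypothesis.Theorems.SuzukiWindowsDoorSmallWindowLaw
import Summits.RiemannHypothesis.RiemannHypothesis.Theorems.SuzukiThetaFlowOpNormDecay
import Literature.NumberTheory.LFunctions.WeilWindowSuzukiAsymptoticProofs

/-!
# SuzukiWindowsDoorDecayExponentSmallWindow — the θ-flow DECAY EXPONENT in the small-window limit: `κ_op(t;θ₀,θ₁) = 2 log(1/t) + O(1) ∼ 2ε(t)`, and a bound on Suzuki's constant `μ₁` (column DBR; RH-FREE)

LINE 1 — LABEL: RH-FREE asymptotic theorems (t → 0⁺) about the explicit operator family `𝖪_θ[t]` and Weil's ground energy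
`ε(t) = weilGroundEnergy t`; bears_on: LADDER-RH B-D(b) → B-P(P2) / B-P(P2-flow) (PROOF-OF-DATA for the column's registered
D-0117 experiment EXP-R2a «decay exponent vs Weil ground energy», TARGET-v10 §E.1, in its `t → 0⁺` corner).  WHAT THIS IS
NOT: no sign of `ε(t)` at any fixed `t` is asserted, no window is certified, nothing is a statement about `ζ`'s zeros; the
`∀ t` antitone level stays Weil's criterion re-indexed (RH-EQUIVALENT, not claimed); nothing here bears on the truth of RH.

THE OBSERVABLE (TARGET-v10 §E.1): `κ_op(t; θ₀, θ₁) = (log σ₁(θ₀,t)² − log σ₁(θ₁,t)²)/(θ₁ − θ₀)`, `σ₁(θ,t) = ‖𝖪_θ[t]‖`; the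
decay law at operator level (`SuzukiThetaFlow.opNorm_decay`, eng-2 g5) says `κ_op ≥ 2ε(t)`.  Here, for INTEGER
`θ_i = k_i + 1`, `1 ≤ k₀ < k₁`, any families of bounded realisations `A_i t` of `𝖪_{θ_i}[t]` and any realisations `B_i` of
the onset operators `A_{θ_i}` (kernel `(u+v)₊^{k_i}` on `L²(−1,1)`), with `L_i = c_{θ_i}‖B_i‖`, `c_θ = (2π)^θ/Γ(θ)`:

* §1 **`tendsto_decayExponent_sub_two_mul_log`**: `κ_op(t;θ₀,θ₁) − 2 log(1/t) → 2 log(L₀/L₁)/(θ₁−θ₀)` as `t → 0⁺`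
  (the small-window law `SuzukiWindowsDoorSmallWindowLaw.tendsto_opNorm_winOp_div_pow`: each unit of `θ` costs exactly one
  power of `t`);
* §2 with Column 2's tree theorem `Suzuki2026_thm_1_4_asymptotic_holds` (`ε(t) = log(1/t) + μ₁ − log 2π − γ + O(t)`):
  **`tendsto_decayExponent_sub_two_mul_weilGroundEnergy`** (`κ_op − 2ε → 2 log(L₀/L₁)/(θ₁−θ₀) − 2(μ₁ − log 2π − γ)` for
  the clause's `μ₁`), **`tendsto_decayExponent_div_weilGroundEnergy`** (`κ_op/(2ε) → 1`: the decay law is saturated to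
  leading order as `t → 0⁺`, for EVERY integer pair), and, since `κ_op ≥ 2ε` (`opNorm_decay`), the RH-FREE cross-column
  inequality **`mu_one_le`**: `μ₁ ≤ log 2π + γ + log(L₀/L₁)/(θ₁−θ₀)` for every `μ₁` admissible in Suzuki's asymptotic —
  numerically (pair `(2,3)`, the kernel bounds `‖A₂‖² ≤ 4/3`, `‖A₃‖² ≥ 64/63` of `SuzukiWindowsDoorWindowDilation`)
  **`mu_one_le_explicit`**: `μ₁ ≤ γ + log(√21/2) (≈ 1.406)` (with DATA §ET1f-lite's certified `‖A₂‖, ‖A₃‖`: `≤ 1.03`, not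
  kernel).  READING (theory's to score): the `t → 0⁺` defect `lim (κ_op − 2ε)` is `2 log(θ₀‖A_{θ₀}‖/‖A_{θ₀+1}‖) + 2γ − 2μ₁`
  for consecutive integers — smallest at small `θ₀`, `→ +∞` as `θ₀ → ∞` (`‖A_{θ+1}‖ ≤ 2‖A_θ‖`,
  `SuzukiWindowsDoorKernelMonotone`) — the same direction as EXP-R2a's Q1/Q2 readings (DATA.md §EXP-R2a: κ_op(2→3; t = 0.1)
  = 1.985 scout; here `2 log 10 − 2.779 = 1.83` at leading order).

References: [Su20] M. Suzuki, ASPM 84 (2020) = arXiv:1907.07302; [Su26] M. Suzuki, Thm 1.4 (tree: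
`Literature.NumberTheory.LFunctions.Suzuki2026_thm_1_4_asymptotic_holds`); rh-dbr TARGET-v10 §E.1 (EXP-R2a), §N.3;
DATA.md §ET1f-lite, §EXP-R2a.
-/

noncomputable section

-- D-0017: `Summit.<S>.<S>.…` is the designed namespace of a single-problem summit.
set_option linter.dupNamespace false

open MeasureTheory Set Filter Topology

namespace Summit.RiemannHypothesis.RiemannHypothesis.Theorems.SuzukiWindowsDoorDecayExponentSmallWindow

open Literature.NumberTheory.LFunctions Literature.Analysis.OperatorTheory
open Summit.RiemannHypothesis.RiemannHypothesis.Theorems.SuzukiWindowsDoorTempleGalerkin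
open Summit.RiemannHypothesis.RiemannHypothesis.Theorems.SuzukiWindowsDoorWindowDilation
open Summit.RiemannHypothesis.RiemannHypothesis.Theorems.SuzukiWindowsDoorSmallWindowLaw
open Summit.RiemannHypothesis.RiemannHypothesis.Theorems.SuzukiThetaFlow (opNorm_decay)

section Pair

variable {k₀ k₁ : ℕ} {θ₀ θ₁ : ℝ}
  {A₀ A₁ : ∀ t : ℝ, Lp ℝ 2 (volume.restrict (Ioo (-t) t)) →L[ℝ] Lp ℝ 2 (volume.restrict (Ioo (-t) t))}
  {B₀ B₁ : Lp ℝ 2 (volume.restrict (Ioo (-1 : ℝ) 1)) →L[ℝ] Lp ℝ 2 (volume.restrict (Ioo (-1 : ℝ) 1))}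

/-- RH-FREE · positivity of the law's constant: any realisation `B` of the onset operator has `‖B‖ > 0`. -/
theorem opNorm_onsetOp_pos {k : ℕ} (hk : 1 ≤ k)
    {B : Lp ℝ 2 (volume.restrict (Ioo (-1 : ℝ) 1)) →L[ℝ] Lp ℝ 2 (volume.restrict (Ioo (-1 : ℝ) 1))}
    (hB : ∀ φ, (B φ : ℝ → ℝ) =ᵐ[volume.restrict (Ioo (-1 : ℝ) 1)]
      fun u => ∫ v in Ioo (-1 : ℝ) 1, (max (u + v) 0) ^ k * φ v) : 0 < ‖B‖ := by
  have hk0 : (0 : ℝ) ≤ k := Nat.cast_nonneg k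
  have h := sq_opNorm_onsetOp_ge hk hB
  have hpos : (0 : ℝ) < (2 : ℝ) ^ (2 * k + 2) / (((k : ℝ) + 1) ^ 2 * (2 * (k : ℝ) + 3)) := by positivity
  have hsq : 0 < ‖B‖ ^ 2 := hpos.trans_le h
  rcases (norm_nonneg B).lt_or_eq with h0 | h0
  · exact h0
  · rw [← h0] at hsq; norm_num at hsq

/-- **RH-FREE · THE DECAY EXPONENT IN THE SMALL-WINDOW LIMIT.**  For integer `θ_i = k_i + 1`, `1 ≤ k₀ < k₁`, any families
of bounded realisations `A₀ t`, `A₁ t` of `𝖪_{θ₀}[t]`, `𝖪_{θ₁}[t]` and any realisations `B₀`, `B₁` of the onset operators: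
`κ_op(t;θ₀,θ₁) − 2 log(1/t) → 2·log(L₀/L₁)/(θ₁ − θ₀)` as `t → 0⁺`, `L_i = c_{θ_i}‖B_i‖` — each unit of `θ` costs exactly
one power of `t` in `σ₁(θ,t)`.  Nothing here bears on RH. -/
theorem tendsto_decayExponent_sub_two_mul_log (hk₀ : 1 ≤ k₀) (hk : k₀ < k₁)
    (hθ₀ : θ₀ = (k₀ : ℝ) + 1) (hθ₁ : θ₁ = (k₁ : ℝ) + 1)
    (hA₀ : ∀ t φ, (A₀ t φ : ℝ → ℝ) =ᵐ[volume.restrict (Ioo (-t) t)]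
      fun x => ∫ y in Ioo (-t) t, limKernel θ₀ (x + y) * φ y)
    (hA₁ : ∀ t φ, (A₁ t φ : ℝ → ℝ) =ᵐ[volume.restrict (Ioo (-t) t)]
      fun x => ∫ y in Ioo (-t) t, limKernel θ₁ (x + y) * φ y)
    (hB₀ : ∀ φ, (B₀ φ : ℝ → ℝ) =ᵐ[volume.restrict (Ioo (-1 : ℝ) 1)]
      fun u => ∫ v in Ioo (-1 : ℝ) 1, (max (u + v) 0) ^ k₀ * φ v)
    (hB₁ : ∀ φ, (B₁ φ : ℝ → ℝ) =ᵐ[volume.restrict (Ioo (-1 : ℝ) 1)]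
      fun u => ∫ v in Ioo (-1 : ℝ) 1, (max (u + v) 0) ^ k₁ * φ v) :
    Tendsto (fun t : ℝ => Real.log (‖A₀ t‖ ^ 2 / ‖A₁ t‖ ^ 2) / (θ₁ - θ₀) - 2 * Real.log (1 / t))
      (𝓝[>] 0)
      (𝓝 (2 * Real.log (((2 * Real.pi) ^ (k₀ + 1) / (k₀.factorial : ℝ) * ‖B₀‖) /
          ((2 * Real.pi) ^ (k₁ + 1) / (k₁.factorial : ℝ) * ‖B₁‖)) / (θ₁ - θ₀))) := by
  have hk₁ : 1 ≤ k₁ := le_trans hk₀ hk.le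
  set L₀ : ℝ := (2 * Real.pi) ^ (k₀ + 1) / (k₀.factorial : ℝ) * ‖B₀‖ with hL₀
  set L₁ : ℝ := (2 * Real.pi) ^ (k₁ + 1) / (k₁.factorial : ℝ) * ‖B₁‖ with hL₁
  have hL₀pos : 0 < L₀ := by have := opNorm_onsetOp_pos hk₀ hB₀; positivity
  have hL₁pos : 0 < L₁ := by have := opNorm_onsetOp_pos hk₁ hB₁; positivity
  have hdθ : θ₁ - θ₀ = (k₁ : ℝ) - k₀ := by rw [hθ₀, hθ₁]; ring
  have hdθpos : 0 < θ₁ - θ₀ := by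
    rw [hdθ]
    have : (k₀ : ℝ) < k₁ := by exact_mod_cast hk
    linarith
  -- the two laws
  have hr₀ := tendsto_opNorm_winOp_div_pow hk₀ hθ₀ A₀ hA₀ hB₀
  have hr₁ := tendsto_opNorm_winOp_div_pow hk₁ hθ₁ A₁ hA₁ hB₁
  rw [← hL₀] at hr₀
  rw [← hL₁] at hr₁
  -- eventually both ratios are positive
  have hev₀ : ∀ᶠ t in 𝓝[>] (0 : ℝ), 0 < ‖A₀ t‖ / t ^ (k₀ + 1) := hr₀.eventually (eventually_gt_nhds hL₀pos)
  have hev₁ : ∀ᶠ t in 𝓝[>] (0 : ℝ), 0 < ‖A₁ t‖ / t ^ (k₁ + 1) := hr₁.eventually (eventually_gt_nhds hL₁pos)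
  -- the limit of the logs
  have hlog : Tendsto (fun t : ℝ => 2 * (Real.log (‖A₀ t‖ / t ^ (k₀ + 1)) - Real.log (‖A₁ t‖ / t ^ (k₁ + 1))) /
      (θ₁ - θ₀)) (𝓝[>] 0) (𝓝 (2 * (Real.log L₀ - Real.log L₁) / (θ₁ - θ₀))) :=
    ((((Real.continuousAt_log hL₀pos.ne').tendsto.comp hr₀).sub
      ((Real.continuousAt_log hL₁pos.ne').tendsto.comp hr₁)).const_mul 2).div_const _
  rw [← Real.log_div hL₀pos.ne' hL₁pos.ne'] at hlog
  refine hlog.congr' ?_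
  filter_upwards [hev₀, hev₁, self_mem_nhdsWithin] with t h₀ h₁ ht
  have ht0 : 0 < t := ht
  have htk₀ : 0 < t ^ (k₀ + 1) := pow_pos ht0 _
  have htk₁ : 0 < t ^ (k₁ + 1) := pow_pos ht0 _
  have hn₀ : 0 < ‖A₀ t‖ := by have := mul_pos h₀ htk₀; rwa [div_mul_cancel₀ _ htk₀.ne'] at this
  have hn₁ : 0 < ‖A₁ t‖ := by have := mul_pos h₁ htk₁; rwa [div_mul_cancel₀ _ htk₁.ne'] at this
  rw [Real.log_div hn₀.ne' htk₀.ne', Real.log_div hn₁.ne' htk₁.ne', Real.log_pow, Real.log_pow,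
    Real.log_div (pow_pos hn₀ 2).ne' (pow_pos hn₁ 2).ne', Real.log_pow, Real.log_pow, one_div, Real.log_inv, hdθ]
  have hne : (k₁ : ℝ) - k₀ ≠ 0 := by rw [← hdθ]; exact hdθpos.ne'
  field_simp
  push_cast
  ring

/-- RH-FREE · `κ_op ≥ 2ε(t)` at the operator level (eng-2 g5's `opNorm_decay`, rewritten): for `t > 0`, `1 < θ₀ ≤ θ₁` and
realisations with `‖A₁‖ > 0`, `2ε(t) ≤ log(‖A₀‖²/‖A₁‖²)/(θ₁ − θ₀)` when `θ₀ < θ₁`.  No sign of `ε(t)` is asserted. -/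
theorem two_mul_weilGroundEnergy_le_decayExponent {t : ℝ} (ht : 0 < t) (hθ₀ : 1 < θ₀) (hθ : θ₀ < θ₁)
    {a₀ a₁ : Lp ℝ 2 (volume.restrict (Ioo (-t) t)) →L[ℝ] Lp ℝ 2 (volume.restrict (Ioo (-t) t))}
    (ha₀ : ∀ φ, (a₀ φ : ℝ → ℝ) =ᵐ[volume.restrict (Ioo (-t) t)] fun x => ∫ y in Ioo (-t) t, limKernel θ₀ (x + y) * φ y)
    (ha₁ : ∀ φ, (a₁ φ : ℝ → ℝ) =ᵐ[volume.restrict (Ioo (-t) t)] fun x => ∫ y in Ioo (-t) t, limKernel θ₁ (x + y) * φ y)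
    (hpos : 0 < ‖a₁‖) :
    2 * weilGroundEnergy t ≤ Real.log (‖a₀‖ ^ 2 / ‖a₁‖ ^ 2) / (θ₁ - θ₀) := by
  have hd := opNorm_decay ht hθ₀ hθ.le ha₀ ha₁
  have hdθ : 0 < θ₁ - θ₀ := by linarith
  have h0 : 0 < ‖a₀‖ := by
    have : 0 < Real.exp (-weilGroundEnergy t * (θ₁ - θ₀)) * ‖a₀‖ := hpos.trans_le hd
    exact pos_of_mul_pos_right this (Real.exp_pos _).le
  have hlog := Real.log_le_log hpos hd
  rw [Real.log_mul (Real.exp_pos _).ne' h0.ne', Real.log_exp] at hlog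
  rw [le_div_iff₀ hdθ, Real.log_div (pow_pos h0 2).ne' (pow_pos hpos 2).ne', Real.log_pow, Real.log_pow]
  push_cast
  nlinarith

/-- **RH-FREE · the decay exponent against Weil's ground energy, small windows**: for every `μ₁, C, a₀` as in Suzuki's
asymptotic `|ε(a) − (log(1/a) + μ₁ − log 2π − γ)| ≤ Ca` (`0 < a ≤ a₀`; the tree theorem `Suzuki2026_thm_1_4_asymptotic_holds`
provides such), `κ_op(t;θ₀,θ₁) − 2ε(t) → 2 log(L₀/L₁)/(θ₁−θ₀) − 2(μ₁ − log 2π − γ)` as `t → 0⁺`. -/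
theorem tendsto_decayExponent_sub_two_mul_weilGroundEnergy (hk₀ : 1 ≤ k₀) (hk : k₀ < k₁)
    (hθ₀ : θ₀ = (k₀ : ℝ) + 1) (hθ₁ : θ₁ = (k₁ : ℝ) + 1)
    (hA₀ : ∀ t φ, (A₀ t φ : ℝ → ℝ) =ᵐ[volume.restrict (Ioo (-t) t)]
      fun x => ∫ y in Ioo (-t) t, limKernel θ₀ (x + y) * φ y)
    (hA₁ : ∀ t φ, (A₁ t φ : ℝ → ℝ) =ᵐ[volume.restrict (Ioo (-t) t)]
      fun x => ∫ y in Ioo (-t) t, limKernel θ₁ (x + y) * φ y)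
    (hB₀ : ∀ φ, (B₀ φ : ℝ → ℝ) =ᵐ[volume.restrict (Ioo (-1 : ℝ) 1)]
      fun u => ∫ v in Ioo (-1 : ℝ) 1, (max (u + v) 0) ^ k₀ * φ v)
    (hB₁ : ∀ φ, (B₁ φ : ℝ → ℝ) =ᵐ[volume.restrict (Ioo (-1 : ℝ) 1)]
      fun u => ∫ v in Ioo (-1 : ℝ) 1, (max (u + v) 0) ^ k₁ * φ v)
    {μ₁ C a₀ : ℝ} (ha₀ : 0 < a₀)
    (hε : ∀ a : ℝ, 0 < a → a ≤ a₀ → |weilGroundEnergy a -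
        (Real.log (1 / a) + μ₁ - Real.log (2 * Real.pi) - Real.eulerMascheroniConstant)| ≤ C * a) :
    Tendsto (fun t : ℝ => Real.log (‖A₀ t‖ ^ 2 / ‖A₁ t‖ ^ 2) / (θ₁ - θ₀) - 2 * weilGroundEnergy t)
      (𝓝[>] 0)
      (𝓝 (2 * Real.log (((2 * Real.pi) ^ (k₀ + 1) / (k₀.factorial : ℝ) * ‖B₀‖) /
          ((2 * Real.pi) ^ (k₁ + 1) / (k₁.factorial : ℝ) * ‖B₁‖)) / (θ₁ - θ₀) -
        2 * (μ₁ - Real.log (2 * Real.pi) - Real.eulerMascheroniConstant))) := by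
  have h1 := tendsto_decayExponent_sub_two_mul_log hk₀ hk hθ₀ hθ₁ hA₀ hA₁ hB₀ hB₁
  -- `ε(t) − log(1/t) → μ₁ − log 2π − γ`
  have h2 : Tendsto (fun t : ℝ => weilGroundEnergy t - Real.log (1 / t)) (𝓝[>] 0)
      (𝓝 (μ₁ - Real.log (2 * Real.pi) - Real.eulerMascheroniConstant)) := by
    have key : ∀ᶠ t in 𝓝[>] (0 : ℝ), ‖(weilGroundEnergy t - Real.log (1 / t)) -
        (μ₁ - Real.log (2 * Real.pi) - Real.eulerMascheroniConstant)‖ ≤ |C| * t := by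
      filter_upwards [Ioo_mem_nhdsGT ha₀] with t ht
      rw [Real.norm_eq_abs, show weilGroundEnergy t - Real.log (1 / t) -
          (μ₁ - Real.log (2 * Real.pi) - Real.eulerMascheroniConstant) =
        weilGroundEnergy t - (Real.log (1 / t) + μ₁ - Real.log (2 * Real.pi) - Real.eulerMascheroniConstant) by ring]
      exact (hε t ht.1 ht.2.le).trans (mul_le_mul_of_nonneg_right (le_abs_self C) ht.1.le)
    have hlim : Tendsto (fun t : ℝ => |C| * t) (𝓝[>] 0) (𝓝 0) := by
      have h : Tendsto (fun t : ℝ => |C| * t) (𝓝 0) (𝓝 (|C| * 0)) := (continuous_const.mul continuous_id).tendsto 0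
      rw [mul_zero] at h
      exact h.mono_left nhdsWithin_le_nhds
    exact tendsto_sub_nhds_zero_iff.1 (squeeze_zero_norm' key hlim)
  have h3 := h1.sub (h2.const_mul 2)
  refine h3.congr' (Eventually.of_forall fun t => ?_)
  simp only
  ring

/-- **RH-FREE · the decay law is saturated to leading order as `t → 0⁺`**: `κ_op(t;θ₀,θ₁)/(2ε(t)) → 1` for every pair of
integers `2 ≤ θ₀ < θ₁` and any realisations (both sides are `2 log(1/t) + O(1)`; uses Column 2's
`Suzuki2026_thm_1_4_asymptotic_holds`).  No sign of `ε` at a fixed `t` is asserted; nothing here bears on RH. -/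
theorem tendsto_decayExponent_div_weilGroundEnergy (hk₀ : 1 ≤ k₀) (hk : k₀ < k₁)
    (hθ₀ : θ₀ = (k₀ : ℝ) + 1) (hθ₁ : θ₁ = (k₁ : ℝ) + 1)
    (hA₀ : ∀ t φ, (A₀ t φ : ℝ → ℝ) =ᵐ[volume.restrict (Ioo (-t) t)]
      fun x => ∫ y in Ioo (-t) t, limKernel θ₀ (x + y) * φ y)
    (hA₁ : ∀ t φ, (A₁ t φ : ℝ → ℝ) =ᵐ[volume.restrict (Ioo (-t) t)]
      fun x => ∫ y in Ioo (-t) t, limKernel θ₁ (x + y) * φ y)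
    (hB₀ : ∀ φ, (B₀ φ : ℝ → ℝ) =ᵐ[volume.restrict (Ioo (-1 : ℝ) 1)]
      fun u => ∫ v in Ioo (-1 : ℝ) 1, (max (u + v) 0) ^ k₀ * φ v)
    (hB₁ : ∀ φ, (B₁ φ : ℝ → ℝ) =ᵐ[volume.restrict (Ioo (-1 : ℝ) 1)]
      fun u => ∫ v in Ioo (-1 : ℝ) 1, (max (u + v) 0) ^ k₁ * φ v) :
    Tendsto (fun t : ℝ => Real.log (‖A₀ t‖ ^ 2 / ‖A₁ t‖ ^ 2) / (θ₁ - θ₀) / (2 * weilGroundEnergy t))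
      (𝓝[>] 0) (𝓝 1) := by
  obtain ⟨μ₁, _, C, a₀, ha₀, hε⟩ := Suzuki2026_thm_1_4_asymptotic_holds
  have hg := tendsto_decayExponent_sub_two_mul_weilGroundEnergy hk₀ hk hθ₀ hθ₁ hA₀ hA₁ hB₀ hB₁ ha₀ hε
  -- `2ε(t) → +∞`
  have hεinf : Tendsto (fun t : ℝ => 2 * weilGroundEnergy t) (𝓝[>] 0) atTop := by
    have hlog : Tendsto (fun t : ℝ => Real.log (1 / t)) (𝓝[>] 0) atTop := by
      have h := tendsto_neg_atBot_atTop.comp Real.tendsto_log_nhdsGT_zero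
      refine h.congr' (Eventually.of_forall fun t => ?_)
      simp [Real.log_inv]
    have hlow : ∀ᶠ t in 𝓝[>] (0 : ℝ), Real.log (1 / t) + (μ₁ - Real.log (2 * Real.pi) -
        Real.eulerMascheroniConstant - |C| * a₀) ≤ weilGroundEnergy t := by
      filter_upwards [Ioo_mem_nhdsGT ha₀] with t ht
      have h := (abs_le.mp (hε t ht.1 ht.2.le)).1
      have hCt : C * t ≤ |C| * a₀ := (mul_le_mul_of_nonneg_right (le_abs_self C) ht.1.le).trans
        (mul_le_mul_of_nonneg_left ht.2.le (abs_nonneg C))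
      linarith
    have h1 : Tendsto (fun t : ℝ => Real.log (1 / t) + (μ₁ - Real.log (2 * Real.pi) -
        Real.eulerMascheroniConstant - |C| * a₀)) (𝓝[>] 0) atTop := tendsto_atTop_add_const_right _ _ hlog
    have h2 : Tendsto (fun t : ℝ => weilGroundEnergy t) (𝓝[>] 0) atTop := tendsto_atTop_mono' _ hlow h1
    exact h2.const_mul_atTop two_pos
  -- `κ/(2ε) = 1 + (κ − 2ε)/(2ε)` eventually
  have hq : Tendsto (fun t : ℝ => (Real.log (‖A₀ t‖ ^ 2 / ‖A₁ t‖ ^ 2) / (θ₁ - θ₀) - 2 * weilGroundEnergy t) /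
      (2 * weilGroundEnergy t)) (𝓝[>] 0) (𝓝 0) := hg.div_atTop hεinf
  have hdθ : 0 < θ₁ - θ₀ := by
    rw [hθ₀, hθ₁]; have : (k₀ : ℝ) < k₁ := by exact_mod_cast hk
    linarith
  have h3 := hq.const_add 1
  rw [add_zero] at h3
  refine h3.congr' ?_
  filter_upwards [hεinf.eventually (eventually_gt_atTop 0)] with t ht
  have hε0 : weilGroundEnergy t ≠ 0 := by
    intro h0; rw [h0, mul_zero] at ht; exact lt_irrefl _ ht
  have hne' : θ₁ - θ₀ ≠ 0 := hdθ.ne'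
  field_simp
  ring

/-- **RH-FREE · CROSS-COLUMN BOUND ON SUZUKI'S CONSTANT `μ₁`**: for every `μ₁` admissible in the small-window asymptotic
`|ε(a) − (log(1/a) + μ₁ − log 2π − γ)| ≤ Ca` (`0 < a ≤ a₀`) and every integer pair `2 ≤ θ₀ < θ₁` with realisations as above,
`μ₁ ≤ log 2π + γ + log(L₀/L₁)/(θ₁ − θ₀)`, `L_i = c_{θ_i}‖B_i‖` — because `κ_op ≥ 2ε` (the θ-flow decay law,
`opNorm_decay`) and both sides are `2 log(1/t) + (explicit constant) + o(1)`.  RH-FREE (decay law + Suzuki 2026 Thm 1.4 are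
tree theorems); nothing here bears on RH. -/
theorem mu_one_le (hk₀ : 1 ≤ k₀) (hk : k₀ < k₁)
    (hθ₀ : θ₀ = (k₀ : ℝ) + 1) (hθ₁ : θ₁ = (k₁ : ℝ) + 1)
    (hA₀ : ∀ t φ, (A₀ t φ : ℝ → ℝ) =ᵐ[volume.restrict (Ioo (-t) t)]
      fun x => ∫ y in Ioo (-t) t, limKernel θ₀ (x + y) * φ y)
    (hA₁ : ∀ t φ, (A₁ t φ : ℝ → ℝ) =ᵐ[volume.restrict (Ioo (-t) t)]
      fun x => ∫ y in Ioo (-t) t, limKernel θ₁ (x + y) * φ y)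
    (hB₀ : ∀ φ, (B₀ φ : ℝ → ℝ) =ᵐ[volume.restrict (Ioo (-1 : ℝ) 1)]
      fun u => ∫ v in Ioo (-1 : ℝ) 1, (max (u + v) 0) ^ k₀ * φ v)
    (hB₁ : ∀ φ, (B₁ φ : ℝ → ℝ) =ᵐ[volume.restrict (Ioo (-1 : ℝ) 1)]
      fun u => ∫ v in Ioo (-1 : ℝ) 1, (max (u + v) 0) ^ k₁ * φ v)
    {μ₁ C a₀ : ℝ} (ha₀ : 0 < a₀)
    (hε : ∀ a : ℝ, 0 < a → a ≤ a₀ → |weilGroundEnergy a -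
        (Real.log (1 / a) + μ₁ - Real.log (2 * Real.pi) - Real.eulerMascheroniConstant)| ≤ C * a) :
    μ₁ ≤ Real.log (2 * Real.pi) + Real.eulerMascheroniConstant +
      Real.log (((2 * Real.pi) ^ (k₀ + 1) / (k₀.factorial : ℝ) * ‖B₀‖) /
          ((2 * Real.pi) ^ (k₁ + 1) / (k₁.factorial : ℝ) * ‖B₁‖)) / (θ₁ - θ₀) := by
  have hk₁ : 1 ≤ k₁ := le_trans hk₀ hk.le
  have hθ₀1 : 1 < θ₀ := by
    rw [hθ₀]; have : (1 : ℝ) ≤ k₀ := by exact_mod_cast hk₀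
    linarith
  have hθlt : θ₀ < θ₁ := by
    rw [hθ₀, hθ₁]; have : (k₀ : ℝ) < k₁ := by exact_mod_cast hk
    linarith
  have hg := tendsto_decayExponent_sub_two_mul_weilGroundEnergy hk₀ hk hθ₀ hθ₁ hA₀ hA₁ hB₀ hB₁ ha₀ hε
  -- eventually `‖A₁ t‖ > 0` (law at θ₁), hence `κ_op − 2ε ≥ 0`
  set L₁ : ℝ := (2 * Real.pi) ^ (k₁ + 1) / (k₁.factorial : ℝ) * ‖B₁‖ with hL₁
  have hL₁pos : 0 < L₁ := by have := opNorm_onsetOp_pos hk₁ hB₁; positivity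
  have hr₁ := tendsto_opNorm_winOp_div_pow hk₁ hθ₁ A₁ hA₁ hB₁
  rw [← hL₁] at hr₁
  have hev : ∀ᶠ t in 𝓝[>] (0 : ℝ),
      0 ≤ Real.log (‖A₀ t‖ ^ 2 / ‖A₁ t‖ ^ 2) / (θ₁ - θ₀) - 2 * weilGroundEnergy t := by
    filter_upwards [hr₁.eventually (eventually_gt_nhds hL₁pos), self_mem_nhdsWithin] with t h₁ ht
    have ht0 : 0 < t := ht
    have htk : 0 < t ^ (k₁ + 1) := pow_pos ht0 _
    have hn₁ : 0 < ‖A₁ t‖ := by have := mul_pos h₁ htk; rwa [div_mul_cancel₀ _ htk.ne'] at this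
    have h := two_mul_weilGroundEnergy_le_decayExponent ht0 hθ₀1 hθlt (hA₀ t) (hA₁ t) hn₁
    linarith
  have h0 : 0 ≤ 2 * Real.log (((2 * Real.pi) ^ (k₀ + 1) / (k₀.factorial : ℝ) * ‖B₀‖) / L₁) / (θ₁ - θ₀) -
      2 * (μ₁ - Real.log (2 * Real.pi) - Real.eulerMascheroniConstant) :=
    ge_of_tendsto hg hev
  have hdθ : 0 < θ₁ - θ₀ := by linarith
  have : Real.log (((2 * Real.pi) ^ (k₀ + 1) / (k₀.factorial : ℝ) * ‖B₀‖) / L₁) / (θ₁ - θ₀) =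
      2 * Real.log (((2 * Real.pi) ^ (k₀ + 1) / (k₀.factorial : ℝ) * ‖B₀‖) / L₁) / (θ₁ - θ₀) / 2 := by ring
  linarith

end Pair

/-- **RH-FREE · EXPLICIT INSTANCE**: `μ₁ ≤ γ + log(√21/2) (≈ 1.406)` for every `μ₁` admissible in Suzuki's small-window
asymptotic — the pair `(θ₀, θ₁) = (2, 3)` (`c₂/c₃ = 1/π`) with the kernel bounds `‖A₂‖² ≤ 4/3`, `‖A₃‖² ≥ 64/63`
(`SuzukiWindowsDoorWindowDilation`); realisations exist by the tree's `L²`-kernel package (`exists_winOp`).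
(With DATA §ET1f-lite's certified `‖A₂‖ = 1.1377`, `‖A₃‖ = 1.4530` the same argument reads `μ₁ ≤ 1.03` — numerics, not
kernel.)  A cross-column consistency inequality; nothing here bears on RH. -/
theorem mu_one_le_explicit {μ₁ C a₀ : ℝ} (ha₀ : 0 < a₀)
    (hε : ∀ a : ℝ, 0 < a → a ≤ a₀ → |weilGroundEnergy a -
        (Real.log (1 / a) + μ₁ - Real.log (2 * Real.pi) - Real.eulerMascheroniConstant)| ≤ C * a) :
    μ₁ ≤ Real.eulerMascheroniConstant + Real.log (Real.sqrt 21 / 2) := by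
  -- realisations
  have hK₂ : Continuous (limKernel 2) := Suzuki2020_thm12_continuous (by norm_num)
  have hK₃ : Continuous (limKernel 3) := Suzuki2020_thm12_continuous (by norm_num)
  have hb₁ : Continuous fun w : ℝ => (max w 0) ^ 1 := (continuous_id.max continuous_const).pow 1
  have hb₂ : Continuous fun w : ℝ => (max w 0) ^ 2 := (continuous_id.max continuous_const).pow 2
  choose A₀ hA₀ using fun t : ℝ => exists_winOp hK₂ t
  choose A₁ hA₁ using fun t : ℝ => exists_winOp hK₃ t
  obtain ⟨B₀, hB₀⟩ := exists_winOp hb₁ 1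
  obtain ⟨B₁, hB₁⟩ := exists_winOp hb₂ 1
  have h := mu_one_le (k₀ := 1) (k₁ := 2) (θ₀ := 2) (θ₁ := 3) (A₀ := A₀) (A₁ := A₁) le_rfl one_lt_two
    (by norm_num) (by norm_num) hA₀ hA₁ hB₀ hB₁ ha₀ hε
  -- bounds on the onset norms
  have hB₀pos := opNorm_onsetOp_pos le_rfl hB₀
  have hB₁pos := opNorm_onsetOp_pos (by norm_num : 1 ≤ 2) hB₁
  have hu : ‖B₀‖ ^ 2 ≤ 4 / 3 := by
    have h := sq_opNorm_onsetOp_le le_rfl hB₀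
    have e : (2 : ℝ) ^ (2 * 1 + 2) / ((2 * ((1 : ℕ) : ℝ) + 1) * (2 * ((1 : ℕ) : ℝ) + 2)) = 4 / 3 := by norm_num
    exact h.trans_eq e
  have hl : 64 / 63 ≤ ‖B₁‖ ^ 2 := by
    have h := sq_opNorm_onsetOp_ge (k := 2) (by norm_num) hB₁
    have e : (2 : ℝ) ^ (2 * 2 + 2) / ((((2 : ℕ) : ℝ) + 1) ^ 2 * (2 * ((2 : ℕ) : ℝ) + 3)) = 64 / 63 := by norm_num
    exact e.symm.trans_le h
  -- the ratio `L₀/L₁ = ‖B₀‖/(π‖B₁‖) ≤ √21/(4π)`... compare squares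
  have hπ := Real.pi_pos
  have hratio : ((2 * Real.pi) ^ (1 + 1) / ((1 : ℕ).factorial : ℝ) * ‖B₀‖) /
      ((2 * Real.pi) ^ (2 + 1) / ((2 : ℕ).factorial : ℝ) * ‖B₁‖) = ‖B₀‖ / (Real.pi * ‖B₁‖) := by
    simp only [Nat.factorial]
    push_cast
    field_simp
  rw [hratio, show (3 : ℝ) - 2 = 1 by norm_num, div_one] at h
  -- `‖B₀‖/(π‖B₁‖) ≤ (√21/2)/(2π)`
  have hsq21 : Real.sqrt 21 ^ 2 = 21 := Real.sq_sqrt (by norm_num)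
  have hs0 : 0 < Real.sqrt 21 := Real.sqrt_pos.mpr (by norm_num)
  have hB₀le : ‖B₀‖ ≤ Real.sqrt 21 / 4 * ‖B₁‖ := by
    -- squares: ‖B₀‖² ≤ 4/3 ≤ (21/16)(64/63) ≤ (21/16)‖B₁‖²
    have h2 : ‖B₀‖ ^ 2 ≤ (Real.sqrt 21 / 4 * ‖B₁‖) ^ 2 := by
      rw [mul_pow, div_pow, hsq21]
      nlinarith
    exact (pow_le_pow_iff_left₀ (norm_nonneg _) (by positivity) two_ne_zero).mp h2
  have hq : ‖B₀‖ / (Real.pi * ‖B₁‖) ≤ Real.sqrt 21 / 2 / (2 * Real.pi) := by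
    rw [div_le_div_iff₀ (by positivity) (by positivity)]
    nlinarith [hB₁pos, hπ]
  have hlogle : Real.log (‖B₀‖ / (Real.pi * ‖B₁‖)) ≤ Real.log (Real.sqrt 21 / 2 / (2 * Real.pi)) :=
    Real.log_le_log (by positivity) hq
  have e : Real.log (Real.sqrt 21 / 2 / (2 * Real.pi)) = Real.log (Real.sqrt 21 / 2) - Real.log (2 * Real.pi) :=
    Real.log_div (by positivity) (by positivity)
  rw [e] at hlogle
  linarith

end Summit.RiemannHypothesis.RiemannHypothesis.Theorems.SuzukiWindowsDoorDecayExponentSmallWindow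

end
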